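/-
Copyright: the b2b-balaban T⁴-continuum CRUX team, row NE7b OWNER lineage `t4-ne7b-p1` (gen 106). Project licence.
-/
import Summits.QuantumFields.BalabanUV.T4Continuum.Spine.NE7b.LocalPerturbationSandwich

/-!
# THE ONE-SIDED SANDWICH: the numerator of the perturbed conditional moment needs only STABILITY (`V₁ ≥ −v⁻`) on its support,
# the denominator only SMALLNESS (`V₁ ≤ v⁺`) on a WINDOW carrying mass — residual (R2) where the small-field bounds fail
# (row NE7b, node U5c; kernel theorems of real analysis)

Cell `pub-balaban`, sub-cell `t4`, spine estimate NE7b (`T4WeightBudget.RelWeightBound`; the cell's OWN estimate — NOT PRINTED in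
[Bałaban 1983–89], NOT PROVED).  Crux-route work under `Spine/NE7b/` by the row's OWNER; NOTHING of Bałaban's is named or asserted;
no `T4Continuum/Support` leaf typed; no `def`; zero `sorry`.

WHY.  `…NE7b.LocalPerturbationSandwich` reduced the non-Gaussian small-field remainder (R2) to a TWO-SIDED sup bound `|V₁| ≤ v` of
the near part of the perturbation on the small-field support `{F₁ ≠ 0 ∧ F₂ ≠ 0}` of ONE restriction `F₁·F₂` used in the numerator
AND the denominator.  Two located facts about the LCS step strain that letter: (i) the numerator of a PINNED step's carrier is NOT
restricted to small fresh fields on the pinned region (the Chebyshev split of `…LocalConditionalStability.chebyshev_extraction` has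
converted the large-field indicator there into `e^{−δθ}·e^{δQ}`), and the support of a pinned term contains backgrounds large on
earlier regions — where only POSITIVITY of the action is available, not smallness of its non-quadratic part (the refuter's located
caution on `…CarrierOnSupport`, «positivity there is [Balaban1989LargeFieldI] (0.4)-class»; owner memo `A1C-LCS-RESIDUAL-g105.md`
§3); (ii) the denominator of the one-step kernel is the UNRESTRICTED normalisation, which one is free to bound BELOW by any window.
THIS FILE proves the ONE-SIDED form that fits both: with a numerator near restriction `F₁ᴺ`, a denominator near restriction `F₁ᴰ`
and a WINDOW `0 ≤ G₁ ≤ F₁ᴰ` (all `≥ 0`, far factor `F₂ ≥ 0` common),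
**`∫ F₁ᴺF₂·e^{Q}·e^{−S}·e^{−V} ≤ e^{v⁻ + v⁺}·C·∫ F₁ᴰF₂·e^{−S}·e^{−V}`** as soon as
(a) STABILITY `−v⁻ ≤ V₁` on the numerator's support `{F₁ᴺ ≠ 0 ∧ F₂ ≠ 0}` (one-sided: the standard stability bound of constructive
field theory, in print from the positivity of the Wilson action), (b) SMALLNESS `V₁ ≤ v⁺` on the window's support `{G₁ ≠ 0 ∧ F₂ ≠ 0}`
only, and (c) the UNPERTURBED shifted near-block moments of `F₁ᴺ·e^{Q₁}` are `≤ C·`(those of the window `G₁`) on `{F₂ ≠ 0}` — the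
gen-105 hypothesis `hfib` with the window as denominator; `hfib_window_of_mass` composes it from the gen-105 form against `F₁ᴰ` and a
window mass fraction `∫(F₁ᴰ − G₁)e^{−sh} ≤ η·∫F₁ᴰe^{−sh}` (`η < 1`), constant `C∕(1−η)`.  The far part `V₂(x₂)` again enters nowhere.
The two-sided theorem of `…LocalPerturbationSandwich` is the case `F₁ᴺ = F₁ᴰ = G₁`, `v⁻ = v⁺ = v`.

WHAT IS PROVED ([folklore]; Bochner monotonicity, the gen-105 Fubini lemma `integral_le_of_fibrewise_sum`, real arithmetic):
* §1 **`integral_le_of_sandwich₂`** (any measure; exponents `v₁` up, `v₂` down ⟹ factor `e^{v₁+v₂}`), `le_window_of_mass`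
  (`∫N ≤ C∫D`, `∫D − ∫W ≤ η∫D`, `η < 1` ⟹ `∫N ≤ C∕(1−η)·∫W`).
* §2 **`restrictedMoment_le_of_shifted_fibres₂`** (the gen-105 fibrewise theorem with DIFFERENT near restrictions in numerator and
  denominator — its proof never used their equality), `hfib_window_of_mass`.
* §3 **`perturbedMoment_le_of_stability_window`** (the statement above) and `perturbedMoment_le_of_stability_window_mass` (with the
  window mass fraction displayed instead, factor `e^{v⁻+v⁺}·C∕(1−η)`).

NOT HERE (honest): which window and which stability constant Bałaban's densities afford ((A1c) reading: positivity of the Wilson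
action [Balaban1989LargeFieldI] (0.1)∕(0.4), the analyticity bounds of the effective actions); the induced-mean energies (R1″) behind
the unperturbed fibre hypothesis; anything of Bałaban's.  NE7b NOT PRINTED ∕ NOT PROVED; spine PROVED 0∕9; rung (B)+1 on a FINITE
torus — NOT infinite volume, NOT the mass gap, NOT Clay.
HONEST DEPENDENCY: continuum YM on T⁴ ⇐ BetaPertH ∧ nine spine estimates (0/9 proved); BetaPertH ⇐ (D1) ∧ (D4) ∧ CAP+tail.
-/

set_option autoImplicit false

open Matrix Finset MeasureTheory Real
open Summit.QuantumFields.BalabanUV.T4Continuum.NE7b.GaussianBlockDecoupling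
open Summit.QuantumFields.BalabanUV.T4Continuum.NE7b.GaussianFibrewiseDecoupling
open Summit.QuantumFields.BalabanUV.T4Continuum.NE7b.LocalPerturbationSandwich

namespace Summit.QuantumFields.BalabanUV.T4Continuum.NE7b.StabilityWindowSandwich

/-! ## §1 The one-sided sandwich integrates; a window carrying mass may replace the denominator -/

section Sandwich

variable {X : Type*} [MeasurableSpace X] (μ : Measure X)

/-- **THE ONE-SIDED SANDWICH INTEGRATES** (any measure): `0 ≤ A' ≤ e^{v₁}·A` (numerator: STABILITY side), `0 ≤ B ≤ e^{v₂}·B'`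
(denominator: SMALLNESS side), `A` and `B'` integrable, `0 ≤ C`, `∫A ≤ C·∫B` ⟹ `∫A' ≤ e^{v₁+v₂}·C·∫B'`. [folklore] -/
theorem integral_le_of_sandwich₂ {A B A' B' : X → ℝ} {C v₁ v₂ : ℝ} (hC : 0 ≤ C) (hA' : ∀ x, 0 ≤ A' x) (hB : ∀ x, 0 ≤ B x)
    (hAA : ∀ x, A' x ≤ exp v₁ * A x) (hBB : ∀ x, B x ≤ exp v₂ * B' x) (hAi : Integrable A μ) (hB'i : Integrable B' μ)
    (hmom : ∫ x, A x ∂μ ≤ C * ∫ x, B x ∂μ) :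
    ∫ x, A' x ∂μ ≤ (exp (v₁ + v₂) * C) * ∫ x, B' x ∂μ := by
  have h1 : ∫ x, A' x ∂μ ≤ exp v₁ * ∫ x, A x ∂μ := by
    rw [← integral_const_mul]
    exact integral_mono_of_nonneg (Filter.Eventually.of_forall hA') (hAi.const_mul _) (Filter.Eventually.of_forall hAA)
  have h2 : ∫ x, B x ∂μ ≤ exp v₂ * ∫ x, B' x ∂μ := by
    rw [← integral_const_mul]
    exact integral_mono_of_nonneg (Filter.Eventually.of_forall hB) (hB'i.const_mul _) (Filter.Eventually.of_forall hBB)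
  calc ∫ x, A' x ∂μ ≤ exp v₁ * ∫ x, A x ∂μ := h1
    _ ≤ exp v₁ * (C * ∫ x, B x ∂μ) := mul_le_mul_of_nonneg_left hmom (exp_pos _).le
    _ ≤ exp v₁ * (C * (exp v₂ * ∫ x, B' x ∂μ)) :=
        mul_le_mul_of_nonneg_left (mul_le_mul_of_nonneg_left h2 hC) (exp_pos _).le
    _ = (exp (v₁ + v₂) * C) * ∫ x, B' x ∂μ := by rw [exp_add]; ring

/-- **A WINDOW CARRYING MASS MAY REPLACE THE DENOMINATOR** (real arithmetic): `N ≤ C·D`, `D − W ≤ η·D` with `η < 1` and `0 ≤ C`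
give `N ≤ C∕(1−η)·W`. [folklore] -/
theorem le_window_of_mass {N D W C η : ℝ} (hC : 0 ≤ C) (hη : η < 1) (hND : N ≤ C * D) (hW : D - W ≤ η * D) :
    N ≤ C / (1 - η) * W := by
  have h1 : 0 < 1 - η := sub_pos.2 hη
  have hD : D ≤ W / (1 - η) := by
    rw [le_div_iff₀ h1]; nlinarith
  calc N ≤ C * D := hND
    _ ≤ C * (W / (1 - η)) := mul_le_mul_of_nonneg_left hD hC
    _ = C / (1 - η) * W := by ring

/-- One-sided pointwise bounds from one-sided bounds on the exponent: `−v ≤ V ⟹ a·e^{−V} ≤ e^{v}·a` and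
`V ≤ v ⟹ a ≤ e^{v}·(a·e^{−V})` for `a ≥ 0`, each asked only where `a ≠ 0`. [folklore] -/
theorem mul_exp_neg_le_of_stability {a V v : ℝ} (ha : 0 ≤ a) (hV : a ≠ 0 → -v ≤ V) : a * exp (-V) ≤ exp v * a := by
  by_cases h0 : a = 0
  · simp [h0]
  · rw [mul_comm (exp v)]
    exact mul_le_mul_of_nonneg_left (exp_le_exp.2 (by linarith [hV h0])) ha

/-- See `mul_exp_neg_le_of_stability`. [folklore] -/
theorem le_mul_exp_neg_of_small {a V v : ℝ} (ha : 0 ≤ a) (hV : a ≠ 0 → V ≤ v) : a ≤ exp v * (a * exp (-V)) := by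
  by_cases h0 : a = 0
  · simp [h0]
  · calc a = (exp v * exp (-v)) * a := by rw [← exp_add, add_neg_cancel, exp_zero, one_mul]
      _ ≤ (exp v * exp (-V)) * a :=
          mul_le_mul_of_nonneg_right (mul_le_mul_of_nonneg_left (exp_le_exp.2 (by linarith [hV h0])) (exp_pos _).le) ha
      _ = exp v * (a * exp (-V)) := by ring

end Sandwich

/-! ## §2 The gen-105 fibrewise theorem with different near restrictions in numerator and denominator -/

section Fibrewise

variable {n₁ n₂ : Type} [Fintype n₁] [Fintype n₂]

/-- **THE RESTRICTED MOMENT WITH COUPLED BLOCKS, NUMERATOR RESTRICTION `F₁ᴺ`, DENOMINATOR RESTRICTION `G₁`** (common far factor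
`F₂ ≥ 0`): if on every far configuration with `F₂ x₂ ≠ 0` the shifted near-block moment of `F₁ᴺ·e^{Q₁}` is at most `C` times the
shifted near-block mass of `G₁`, then the same holds for the whole integrals — the far characteristic function and `S₂₂` do not
enter (`…GaussianFibrewiseDecoupling.restrictedMoment_le_of_shifted_fibres` is the case `F₁ᴺ = G₁`; same proof). [folklore] -/
theorem restrictedMoment_le_of_shifted_fibres₂ (S₁₁ Q₁ : Matrix n₁ n₁ ℝ) (S₁₂ : Matrix n₁ n₂ ℝ) (S₂₂ : Matrix n₂ n₂ ℝ)
    (F₁ G₁ : (n₁ → ℝ) → ℝ) (F₂ : (n₂ → ℝ) → ℝ) {C : ℝ} (hF₂ : ∀ x₂, 0 ≤ F₂ x₂)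
    (hA : Integrable fun x : n₁ ⊕ n₂ → ℝ => (F₁ (fun i => x (Sum.inl i)) * F₂ (fun i => x (Sum.inr i))) *
      (exp (x ⬝ᵥ (Matrix.fromBlocks Q₁ 0 0 (0 : Matrix n₂ n₂ ℝ) *ᵥ x)) *
        exp (-(x ⬝ᵥ (Matrix.fromBlocks S₁₁ S₁₂ S₁₂ᵀ S₂₂ *ᵥ x)))))
    (hB : Integrable fun x : n₁ ⊕ n₂ → ℝ => (G₁ (fun i => x (Sum.inl i)) * F₂ (fun i => x (Sum.inr i))) *
      exp (-(x ⬝ᵥ (Matrix.fromBlocks S₁₁ S₁₂ S₁₂ᵀ S₂₂ *ᵥ x))))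
    (hfib : ∀ x₂, F₂ x₂ ≠ 0 →
      ∫ x₁, F₁ x₁ * (exp (x₁ ⬝ᵥ (Q₁ *ᵥ x₁)) * exp (-(x₁ ⬝ᵥ (S₁₁ *ᵥ x₁) + 2 * (x₁ ⬝ᵥ (S₁₂ *ᵥ x₂))))) ≤
        C * ∫ x₁, G₁ x₁ * exp (-(x₁ ⬝ᵥ (S₁₁ *ᵥ x₁) + 2 * (x₁ ⬝ᵥ (S₁₂ *ᵥ x₂))))) :
    ∫ x : n₁ ⊕ n₂ → ℝ, (F₁ (fun i => x (Sum.inl i)) * F₂ (fun i => x (Sum.inr i))) *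
        (exp (x ⬝ᵥ (Matrix.fromBlocks Q₁ 0 0 (0 : Matrix n₂ n₂ ℝ) *ᵥ x)) *
          exp (-(x ⬝ᵥ (Matrix.fromBlocks S₁₁ S₁₂ S₁₂ᵀ S₂₂ *ᵥ x)))) ≤
      C * ∫ x : n₁ ⊕ n₂ → ℝ, (G₁ (fun i => x (Sum.inl i)) * F₂ (fun i => x (Sum.inr i))) *
        exp (-(x ⬝ᵥ (Matrix.fromBlocks S₁₁ S₁₂ S₁₂ᵀ S₂₂ *ᵥ x))) := by
  refine integral_le_of_fibrewise_sum hA hB fun x₂ => ?_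
  have h1 : ∀ x₁ : n₁ → ℝ, (fun i => Sum.elim x₁ x₂ (Sum.inl i)) = x₁ := fun _ => rfl
  have h2 : ∀ x₁ : n₁ → ℝ, (fun i => Sum.elim x₁ x₂ (Sum.inr i)) = x₂ := fun _ => rfl
  have eA : ∀ x₁ : n₁ → ℝ,
      (F₁ (fun i => Sum.elim x₁ x₂ (Sum.inl i)) * F₂ (fun i => Sum.elim x₁ x₂ (Sum.inr i))) *
        (exp (Sum.elim x₁ x₂ ⬝ᵥ (Matrix.fromBlocks Q₁ 0 0 (0 : Matrix n₂ n₂ ℝ) *ᵥ Sum.elim x₁ x₂)) *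
          exp (-(Sum.elim x₁ x₂ ⬝ᵥ (Matrix.fromBlocks S₁₁ S₁₂ S₁₂ᵀ S₂₂ *ᵥ Sum.elim x₁ x₂)))) =
      (F₂ x₂ * exp (-(x₂ ⬝ᵥ (S₂₂ *ᵥ x₂)))) *
        (F₁ x₁ * (exp (x₁ ⬝ᵥ (Q₁ *ᵥ x₁)) * exp (-(x₁ ⬝ᵥ (S₁₁ *ᵥ x₁) + 2 * (x₁ ⬝ᵥ (S₁₂ *ᵥ x₂)))))) := by
    intro x₁
    rw [qf_fromBlocks_near, h1, h2, qf_fromBlocks_coupled, neg_add, exp_add]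
    ring
  have eB : ∀ x₁ : n₁ → ℝ,
      (G₁ (fun i => Sum.elim x₁ x₂ (Sum.inl i)) * F₂ (fun i => Sum.elim x₁ x₂ (Sum.inr i))) *
        exp (-(Sum.elim x₁ x₂ ⬝ᵥ (Matrix.fromBlocks S₁₁ S₁₂ S₁₂ᵀ S₂₂ *ᵥ Sum.elim x₁ x₂))) =
      (F₂ x₂ * exp (-(x₂ ⬝ᵥ (S₂₂ *ᵥ x₂)))) *
        (G₁ x₁ * exp (-(x₁ ⬝ᵥ (S₁₁ *ᵥ x₁) + 2 * (x₁ ⬝ᵥ (S₁₂ *ᵥ x₂))))) := by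
    intro x₁
    rw [h1, h2, qf_fromBlocks_coupled, neg_add, exp_add]
    ring
  simp_rw [eA, eB, integral_const_mul]
  by_cases h0 : F₂ x₂ = 0
  · rw [h0, zero_mul, zero_mul, zero_mul, mul_zero]
  · have hc : 0 ≤ F₂ x₂ * exp (-(x₂ ⬝ᵥ (S₂₂ *ᵥ x₂))) := mul_nonneg (hF₂ x₂) (exp_pos _).le
    calc F₂ x₂ * exp (-(x₂ ⬝ᵥ (S₂₂ *ᵥ x₂))) *
          ∫ x₁, F₁ x₁ * (exp (x₁ ⬝ᵥ (Q₁ *ᵥ x₁)) * exp (-(x₁ ⬝ᵥ (S₁₁ *ᵥ x₁) + 2 * (x₁ ⬝ᵥ (S₁₂ *ᵥ x₂)))))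
        ≤ F₂ x₂ * exp (-(x₂ ⬝ᵥ (S₂₂ *ᵥ x₂))) *
          (C * ∫ x₁, G₁ x₁ * exp (-(x₁ ⬝ᵥ (S₁₁ *ᵥ x₁) + 2 * (x₁ ⬝ᵥ (S₁₂ *ᵥ x₂))))) :=
          mul_le_mul_of_nonneg_left (hfib x₂ h0) hc
      _ = C * (F₂ x₂ * exp (-(x₂ ⬝ᵥ (S₂₂ *ᵥ x₂))) *
          ∫ x₁, G₁ x₁ * exp (-(x₁ ⬝ᵥ (S₁₁ *ᵥ x₁) + 2 * (x₁ ⬝ᵥ (S₁₂ *ᵥ x₂))))) := by ring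

/-- **THE FIBRE HYPOTHESIS AGAINST A WINDOW FROM THE ONE AGAINST THE FULL RESTRICTION AND A MASS FRACTION** (per far
configuration; real arithmetic): numerator `≤ C·`(mass of `F₁ᴰ`) and (mass of `F₁ᴰ`) − (mass of `G₁`) `≤ η·`(mass of `F₁ᴰ`), `η < 1`
⟹ numerator `≤ C∕(1−η)·`(mass of `G₁`). [folklore] -/
theorem hfib_window_of_mass (S₁₁ Q₁ : Matrix n₁ n₁ ℝ) (S₁₂ : Matrix n₁ n₂ ℝ) (F₁ D₁ G₁ : (n₁ → ℝ) → ℝ)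
    (F₂ : (n₂ → ℝ) → ℝ) {C η : ℝ} (hC : 0 ≤ C) (hη : η < 1)
    (hfib : ∀ x₂, F₂ x₂ ≠ 0 →
      ∫ x₁, F₁ x₁ * (exp (x₁ ⬝ᵥ (Q₁ *ᵥ x₁)) * exp (-(x₁ ⬝ᵥ (S₁₁ *ᵥ x₁) + 2 * (x₁ ⬝ᵥ (S₁₂ *ᵥ x₂))))) ≤
        C * ∫ x₁, D₁ x₁ * exp (-(x₁ ⬝ᵥ (S₁₁ *ᵥ x₁) + 2 * (x₁ ⬝ᵥ (S₁₂ *ᵥ x₂)))))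
    (hmass : ∀ x₂, F₂ x₂ ≠ 0 →
      (∫ x₁, D₁ x₁ * exp (-(x₁ ⬝ᵥ (S₁₁ *ᵥ x₁) + 2 * (x₁ ⬝ᵥ (S₁₂ *ᵥ x₂))))) -
          ∫ x₁, G₁ x₁ * exp (-(x₁ ⬝ᵥ (S₁₁ *ᵥ x₁) + 2 * (x₁ ⬝ᵥ (S₁₂ *ᵥ x₂)))) ≤
        η * ∫ x₁, D₁ x₁ * exp (-(x₁ ⬝ᵥ (S₁₁ *ᵥ x₁) + 2 * (x₁ ⬝ᵥ (S₁₂ *ᵥ x₂))))) :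
    ∀ x₂, F₂ x₂ ≠ 0 →
      ∫ x₁, F₁ x₁ * (exp (x₁ ⬝ᵥ (Q₁ *ᵥ x₁)) * exp (-(x₁ ⬝ᵥ (S₁₁ *ᵥ x₁) + 2 * (x₁ ⬝ᵥ (S₁₂ *ᵥ x₂))))) ≤
        C / (1 - η) * ∫ x₁, G₁ x₁ * exp (-(x₁ ⬝ᵥ (S₁₁ *ᵥ x₁) + 2 * (x₁ ⬝ᵥ (S₁₂ *ᵥ x₂)))) :=
  fun x₂ hx₂ => le_window_of_mass hC hη (hfib x₂ hx₂) (hmass x₂ hx₂)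

end Fibrewise

/-! ## §3 The perturbed moment from stability on the numerator's support and smallness on a window -/

section StabilityWindow

variable {n₁ n₂ : Type} [Fintype n₁] [Fintype n₂]

/-- **STABILITY ON THE NUMERATOR's SUPPORT, SMALLNESS ON A WINDOW OF THE DENOMINATOR.**  Coupled blocks
`[[S₁₁,S₁₂],[S₁₂ᵀ,S₂₂]]`, sacrificed form `Q₁ ⊕ 0`; numerator near restriction `F₁ᴺ ≥ 0`, denominator near restriction `F₁ᴰ` with
a window `0 ≤ G₁ ≤ F₁ᴰ`, common far factor `F₂ ≥ 0`; perturbation `V₁(x) + V₂(x₂)`, `V₂` ARBITRARY.  Hypotheses on `V₁`: STABILITY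
`−v⁻ ≤ V₁ x` where `F₁ᴺ(x₁) ≠ 0 ∧ F₂(x₂) ≠ 0`, SMALLNESS `V₁ x ≤ v⁺` where `G₁(x₁) ≠ 0 ∧ F₂(x₂) ≠ 0`.  If the UNPERTURBED shifted
near-block moments of `F₁ᴺ·e^{Q₁}` are at most `C ≥ 0` times the shifted masses of the window `G₁` on `{F₂ ≠ 0}`, then
`∫ F₁ᴺF₂·e^{Q}·e^{−S}·e^{−V} ≤ e^{v⁻+v⁺}·C·∫ F₁ᴰF₂·e^{−S}·e^{−V}`.  Displayed integrabilities: the hybrid numerator, the hybrid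
window mass (far part perturbed, near part not) and the perturbed denominator. [folklore] -/
theorem perturbedMoment_le_of_stability_window (S₁₁ Q₁ : Matrix n₁ n₁ ℝ) (S₁₂ : Matrix n₁ n₂ ℝ) (S₂₂ : Matrix n₂ n₂ ℝ)
    (F₁ D₁ G₁ : (n₁ → ℝ) → ℝ) (F₂ : (n₂ → ℝ) → ℝ) (V₁ : (n₁ ⊕ n₂ → ℝ) → ℝ) (V₂ : (n₂ → ℝ) → ℝ) {C vm vp : ℝ}
    (hF₁ : ∀ x₁, 0 ≤ F₁ x₁) (hG₁ : ∀ x₁, 0 ≤ G₁ x₁) (hGD : ∀ x₁, G₁ x₁ ≤ D₁ x₁) (hF₂ : ∀ x₂, 0 ≤ F₂ x₂) (hC : 0 ≤ C)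
    (hstab : ∀ x : n₁ ⊕ n₂ → ℝ, F₁ (fun i => x (Sum.inl i)) ≠ 0 → F₂ (fun i => x (Sum.inr i)) ≠ 0 → -vm ≤ V₁ x)
    (hsmall : ∀ x : n₁ ⊕ n₂ → ℝ, G₁ (fun i => x (Sum.inl i)) ≠ 0 → F₂ (fun i => x (Sum.inr i)) ≠ 0 → V₁ x ≤ vp)
    (hA : Integrable fun x : n₁ ⊕ n₂ → ℝ =>
      (F₁ (fun i => x (Sum.inl i)) * (F₂ (fun i => x (Sum.inr i)) * exp (-V₂ (fun i => x (Sum.inr i))))) *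
        (exp (x ⬝ᵥ (Matrix.fromBlocks Q₁ 0 0 (0 : Matrix n₂ n₂ ℝ) *ᵥ x)) *
          exp (-(x ⬝ᵥ (Matrix.fromBlocks S₁₁ S₁₂ S₁₂ᵀ S₂₂ *ᵥ x)))))
    (hW : Integrable fun x : n₁ ⊕ n₂ → ℝ =>
      (G₁ (fun i => x (Sum.inl i)) * (F₂ (fun i => x (Sum.inr i)) * exp (-V₂ (fun i => x (Sum.inr i))))) *
        exp (-(x ⬝ᵥ (Matrix.fromBlocks S₁₁ S₁₂ S₁₂ᵀ S₂₂ *ᵥ x))))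
    (hB' : Integrable fun x : n₁ ⊕ n₂ → ℝ => (D₁ (fun i => x (Sum.inl i)) * F₂ (fun i => x (Sum.inr i))) *
      (exp (-(x ⬝ᵥ (Matrix.fromBlocks S₁₁ S₁₂ S₁₂ᵀ S₂₂ *ᵥ x))) * exp (-(V₁ x + V₂ (fun i => x (Sum.inr i))))))
    (hfib : ∀ x₂, F₂ x₂ ≠ 0 →
      ∫ x₁, F₁ x₁ * (exp (x₁ ⬝ᵥ (Q₁ *ᵥ x₁)) * exp (-(x₁ ⬝ᵥ (S₁₁ *ᵥ x₁) + 2 * (x₁ ⬝ᵥ (S₁₂ *ᵥ x₂))))) ≤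
        C * ∫ x₁, G₁ x₁ * exp (-(x₁ ⬝ᵥ (S₁₁ *ᵥ x₁) + 2 * (x₁ ⬝ᵥ (S₁₂ *ᵥ x₂))))) :
    ∫ x : n₁ ⊕ n₂ → ℝ, (F₁ (fun i => x (Sum.inl i)) * F₂ (fun i => x (Sum.inr i))) *
        ((exp (x ⬝ᵥ (Matrix.fromBlocks Q₁ 0 0 (0 : Matrix n₂ n₂ ℝ) *ᵥ x)) *
          exp (-(x ⬝ᵥ (Matrix.fromBlocks S₁₁ S₁₂ S₁₂ᵀ S₂₂ *ᵥ x)))) * exp (-(V₁ x + V₂ (fun i => x (Sum.inr i))))) ≤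
      (exp (vm + vp) * C) * ∫ x : n₁ ⊕ n₂ → ℝ, (D₁ (fun i => x (Sum.inl i)) * F₂ (fun i => x (Sum.inr i))) *
        (exp (-(x ⬝ᵥ (Matrix.fromBlocks S₁₁ S₁₂ S₁₂ᵀ S₂₂ *ᵥ x))) * exp (-(V₁ x + V₂ (fun i => x (Sum.inr i))))) := by
  have hF₂' : ∀ x₂, 0 ≤ F₂ x₂ * exp (-V₂ x₂) := fun x₂ => mul_nonneg (hF₂ x₂) (exp_pos _).le
  -- the fibrewise theorem with the far weight `F₂·e^{−V₂}` and the window in the denominator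
  have hmom := restrictedMoment_le_of_shifted_fibres₂ S₁₁ Q₁ S₁₂ S₂₂ F₁ G₁ (fun x₂ => F₂ x₂ * exp (-V₂ x₂)) hF₂' hA hW
    fun x₂ hx₂ => hfib x₂ (left_ne_zero_of_mul hx₂)
  refine integral_le_of_sandwich₂ volume hC (fun x => ?_) (fun x => ?_) (fun x => ?_) (fun x => ?_) hA hB' hmom
  · exact mul_nonneg (mul_nonneg (hF₁ _) (hF₂ _)) (mul_nonneg (mul_nonneg (exp_pos _).le (exp_pos _).le) (exp_pos _).le)
  · exact mul_nonneg (mul_nonneg (hG₁ _) (hF₂' _)) (exp_pos _).le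
  · -- numerator, STABILITY side: `A' = A·e^{−V₁} ≤ e^{v⁻}·A`
    have ha : 0 ≤ (F₁ (fun i => x (Sum.inl i)) * (F₂ (fun i => x (Sum.inr i)) * exp (-V₂ (fun i => x (Sum.inr i))))) *
        (exp (x ⬝ᵥ (Matrix.fromBlocks Q₁ 0 0 (0 : Matrix n₂ n₂ ℝ) *ᵥ x)) *
          exp (-(x ⬝ᵥ (Matrix.fromBlocks S₁₁ S₁₂ S₁₂ᵀ S₂₂ *ᵥ x)))) :=
      mul_nonneg (mul_nonneg (hF₁ _) (hF₂' _)) (mul_nonneg (exp_pos _).le (exp_pos _).le)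
    have hs := mul_exp_neg_le_of_stability (V := V₁ x) (v := vm) ha fun hne => hstab x
      (fun h0 => hne (by rw [h0, zero_mul, zero_mul])) (fun h0 => hne (by rw [h0, zero_mul, mul_zero, zero_mul]))
    calc (F₁ (fun i => x (Sum.inl i)) * F₂ (fun i => x (Sum.inr i))) *
          ((exp (x ⬝ᵥ (Matrix.fromBlocks Q₁ 0 0 (0 : Matrix n₂ n₂ ℝ) *ᵥ x)) *
            exp (-(x ⬝ᵥ (Matrix.fromBlocks S₁₁ S₁₂ S₁₂ᵀ S₂₂ *ᵥ x)))) * exp (-(V₁ x + V₂ (fun i => x (Sum.inr i)))))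
        = (F₁ (fun i => x (Sum.inl i)) * (F₂ (fun i => x (Sum.inr i)) * exp (-V₂ (fun i => x (Sum.inr i))))) *
            (exp (x ⬝ᵥ (Matrix.fromBlocks Q₁ 0 0 (0 : Matrix n₂ n₂ ℝ) *ᵥ x)) *
              exp (-(x ⬝ᵥ (Matrix.fromBlocks S₁₁ S₁₂ S₁₂ᵀ S₂₂ *ᵥ x)))) * exp (-V₁ x) := by
          rw [exp_neg_add]; ring
      _ ≤ _ := hs
  · -- window, SMALLNESS side: `W ≤ e^{v⁺}·W·e^{−V₁} ≤ e^{v⁺}·B'` (using `G₁ ≤ F₁ᴰ`)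
    have hb : 0 ≤ (G₁ (fun i => x (Sum.inl i)) * (F₂ (fun i => x (Sum.inr i)) * exp (-V₂ (fun i => x (Sum.inr i))))) *
        exp (-(x ⬝ᵥ (Matrix.fromBlocks S₁₁ S₁₂ S₁₂ᵀ S₂₂ *ᵥ x))) := mul_nonneg (mul_nonneg (hG₁ _) (hF₂' _)) (exp_pos _).le
    have hs := le_mul_exp_neg_of_small (V := V₁ x) (v := vp) hb fun hne => hsmall x
      (fun h0 => hne (by rw [h0, zero_mul, zero_mul])) (fun h0 => hne (by rw [h0, zero_mul, mul_zero, zero_mul]))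
    have hrest : 0 ≤ (F₂ (fun i => x (Sum.inr i)) * exp (-V₂ (fun i => x (Sum.inr i)))) *
        exp (-(x ⬝ᵥ (Matrix.fromBlocks S₁₁ S₁₂ S₁₂ᵀ S₂₂ *ᵥ x))) * exp (-V₁ x) :=
      mul_nonneg (mul_nonneg (hF₂' _) (exp_pos _).le) (exp_pos _).le
    calc (G₁ (fun i => x (Sum.inl i)) * (F₂ (fun i => x (Sum.inr i)) * exp (-V₂ (fun i => x (Sum.inr i))))) *
          exp (-(x ⬝ᵥ (Matrix.fromBlocks S₁₁ S₁₂ S₁₂ᵀ S₂₂ *ᵥ x)))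
        ≤ exp vp * ((G₁ (fun i => x (Sum.inl i)) * (F₂ (fun i => x (Sum.inr i)) * exp (-V₂ (fun i => x (Sum.inr i))))) *
            exp (-(x ⬝ᵥ (Matrix.fromBlocks S₁₁ S₁₂ S₁₂ᵀ S₂₂ *ᵥ x))) * exp (-V₁ x)) := hs
      _ = exp vp * (G₁ (fun i => x (Sum.inl i)) * ((F₂ (fun i => x (Sum.inr i)) * exp (-V₂ (fun i => x (Sum.inr i)))) *
            exp (-(x ⬝ᵥ (Matrix.fromBlocks S₁₁ S₁₂ S₁₂ᵀ S₂₂ *ᵥ x))) * exp (-V₁ x))) := by ring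
      _ ≤ exp vp * (D₁ (fun i => x (Sum.inl i)) * ((F₂ (fun i => x (Sum.inr i)) * exp (-V₂ (fun i => x (Sum.inr i)))) *
            exp (-(x ⬝ᵥ (Matrix.fromBlocks S₁₁ S₁₂ S₁₂ᵀ S₂₂ *ᵥ x))) * exp (-V₁ x))) :=
          mul_le_mul_of_nonneg_left (mul_le_mul_of_nonneg_right (hGD _) hrest) (exp_pos _).le
      _ = exp vp * ((D₁ (fun i => x (Sum.inl i)) * F₂ (fun i => x (Sum.inr i))) *
            (exp (-(x ⬝ᵥ (Matrix.fromBlocks S₁₁ S₁₂ S₁₂ᵀ S₂₂ *ᵥ x))) * exp (-(V₁ x + V₂ (fun i => x (Sum.inr i)))))) := by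
          rw [exp_neg_add]; ring

/-- **THE SAME WITH THE WINDOW's MASS FRACTION DISPLAYED**: the unperturbed fibre hypothesis against the denominator restriction `F₁ᴰ`
(the gen-105 form, constant `C`) and, per far configuration, the window's complement carrying at most the fraction `η < 1` of the
shifted `F₁ᴰ`-mass ⟹ factor `e^{v⁻+v⁺}·C∕(1−η)`. [folklore] -/
theorem perturbedMoment_le_of_stability_window_mass (S₁₁ Q₁ : Matrix n₁ n₁ ℝ) (S₁₂ : Matrix n₁ n₂ ℝ) (S₂₂ : Matrix n₂ n₂ ℝ)
    (F₁ D₁ G₁ : (n₁ → ℝ) → ℝ) (F₂ : (n₂ → ℝ) → ℝ) (V₁ : (n₁ ⊕ n₂ → ℝ) → ℝ) (V₂ : (n₂ → ℝ) → ℝ) {C η vm vp : ℝ}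
    (hF₁ : ∀ x₁, 0 ≤ F₁ x₁) (hG₁ : ∀ x₁, 0 ≤ G₁ x₁) (hGD : ∀ x₁, G₁ x₁ ≤ D₁ x₁) (hF₂ : ∀ x₂, 0 ≤ F₂ x₂) (hC : 0 ≤ C)
    (hη : η < 1)
    (hstab : ∀ x : n₁ ⊕ n₂ → ℝ, F₁ (fun i => x (Sum.inl i)) ≠ 0 → F₂ (fun i => x (Sum.inr i)) ≠ 0 → -vm ≤ V₁ x)
    (hsmall : ∀ x : n₁ ⊕ n₂ → ℝ, G₁ (fun i => x (Sum.inl i)) ≠ 0 → F₂ (fun i => x (Sum.inr i)) ≠ 0 → V₁ x ≤ vp)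
    (hA : Integrable fun x : n₁ ⊕ n₂ → ℝ =>
      (F₁ (fun i => x (Sum.inl i)) * (F₂ (fun i => x (Sum.inr i)) * exp (-V₂ (fun i => x (Sum.inr i))))) *
        (exp (x ⬝ᵥ (Matrix.fromBlocks Q₁ 0 0 (0 : Matrix n₂ n₂ ℝ) *ᵥ x)) *
          exp (-(x ⬝ᵥ (Matrix.fromBlocks S₁₁ S₁₂ S₁₂ᵀ S₂₂ *ᵥ x)))))
    (hW : Integrable fun x : n₁ ⊕ n₂ → ℝ =>
      (G₁ (fun i => x (Sum.inl i)) * (F₂ (fun i => x (Sum.inr i)) * exp (-V₂ (fun i => x (Sum.inr i))))) *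
        exp (-(x ⬝ᵥ (Matrix.fromBlocks S₁₁ S₁₂ S₁₂ᵀ S₂₂ *ᵥ x))))
    (hB' : Integrable fun x : n₁ ⊕ n₂ → ℝ => (D₁ (fun i => x (Sum.inl i)) * F₂ (fun i => x (Sum.inr i))) *
      (exp (-(x ⬝ᵥ (Matrix.fromBlocks S₁₁ S₁₂ S₁₂ᵀ S₂₂ *ᵥ x))) * exp (-(V₁ x + V₂ (fun i => x (Sum.inr i))))))
    (hfib : ∀ x₂, F₂ x₂ ≠ 0 →
      ∫ x₁, F₁ x₁ * (exp (x₁ ⬝ᵥ (Q₁ *ᵥ x₁)) * exp (-(x₁ ⬝ᵥ (S₁₁ *ᵥ x₁) + 2 * (x₁ ⬝ᵥ (S₁₂ *ᵥ x₂))))) ≤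
        C * ∫ x₁, D₁ x₁ * exp (-(x₁ ⬝ᵥ (S₁₁ *ᵥ x₁) + 2 * (x₁ ⬝ᵥ (S₁₂ *ᵥ x₂)))))
    (hmass : ∀ x₂, F₂ x₂ ≠ 0 →
      (∫ x₁, D₁ x₁ * exp (-(x₁ ⬝ᵥ (S₁₁ *ᵥ x₁) + 2 * (x₁ ⬝ᵥ (S₁₂ *ᵥ x₂))))) -
          ∫ x₁, G₁ x₁ * exp (-(x₁ ⬝ᵥ (S₁₁ *ᵥ x₁) + 2 * (x₁ ⬝ᵥ (S₁₂ *ᵥ x₂)))) ≤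
        η * ∫ x₁, D₁ x₁ * exp (-(x₁ ⬝ᵥ (S₁₁ *ᵥ x₁) + 2 * (x₁ ⬝ᵥ (S₁₂ *ᵥ x₂))))) :
    ∫ x : n₁ ⊕ n₂ → ℝ, (F₁ (fun i => x (Sum.inl i)) * F₂ (fun i => x (Sum.inr i))) *
        ((exp (x ⬝ᵥ (Matrix.fromBlocks Q₁ 0 0 (0 : Matrix n₂ n₂ ℝ) *ᵥ x)) *
          exp (-(x ⬝ᵥ (Matrix.fromBlocks S₁₁ S₁₂ S₁₂ᵀ S₂₂ *ᵥ x)))) * exp (-(V₁ x + V₂ (fun i => x (Sum.inr i))))) ≤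
      (exp (vm + vp) * (C / (1 - η))) * ∫ x : n₁ ⊕ n₂ → ℝ, (D₁ (fun i => x (Sum.inl i)) * F₂ (fun i => x (Sum.inr i))) *
        (exp (-(x ⬝ᵥ (Matrix.fromBlocks S₁₁ S₁₂ S₁₂ᵀ S₂₂ *ᵥ x))) * exp (-(V₁ x + V₂ (fun i => x (Sum.inr i))))) :=
  perturbedMoment_le_of_stability_window S₁₁ Q₁ S₁₂ S₂₂ F₁ D₁ G₁ F₂ V₁ V₂ hF₁ hG₁ hGD hF₂
    (div_nonneg hC (sub_pos.2 hη).le) hstab hsmall hA hW hB'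
    (hfib_window_of_mass S₁₁ Q₁ S₁₂ F₁ D₁ G₁ F₂ hC hη hfib hmass)

end StabilityWindow

end Summit.QuantumFields.BalabanUV.T4Continuum.NE7b.StabilityWindowSandwich
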